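import Summits.RiemannHypothesis.RiemannHypothesis.Theorems.ThetaTier1Cheb
import Summits.RiemannHypothesis.RiemannHypothesis.Theorems.ThetaTier1Primes
import HarnessLib

/-!
# THETA tier-1 kernel rows — the HEAD `80 ≤ q < 157`, gap `≥ 4` (ten primes: 83, 89, 97, 103, 109, 113, 127, 131, 139, 151; RH-FREE bookkeeping)

Data module of the tier-1 theta certificate (THETA-CERT-cc6 §D, deposit `EXTREMALS/semilocal/Sq-theta-cc6g7-v1`, kit j215104 — the same
certified two-engine deposit as cc-s2-1 gen21's `ThetaTier1ChebRows{TenK,SixtyK}*`, whose generator `genrows.py`/`genmodules_cheb.py` selected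
`157 ≤ q`; this module, weil-1 gen20, takes the deposit's ten gap-`≥ 4` rows with `80 ≤ q < 157` in the same format, `k` by the same
`karch` rule): rows `(q, q⁺, m, δ·10¹², k)` checked in the kernel by `ThetaTier1.checkAllCheb` (`decide +kernel`; RS-free Chebyshev constant
C(N)) and the resulting REAL certificate inequalities `r.RealCertCheb` (`checkAllCheb_sound`).  With `ThetaTier1UC.walls_of_rows` each row
gives the wall sentence at `q` — in particular at `q = 103` and `q = 109`, the two gap-4 rows of the route item `stmt-RiemannHypothesis-19396`
(`SemilocalRowsToOneFiftySeven`) not yet covered by `SemilocalPolyWitness` kernel theorems.  (Python twin of the checker: all ten PASS, relative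
margins 0.47–0.99.)  Nothing here bears on the truth of RH.
-/

set_option linter.dupNamespace false  -- the mandated namespace repeats `RiemannHypothesis`

namespace Summit.RiemannHypothesis.RiemannHypothesis.Theorems.ThetaTier1

/-- Rows `83 ≤ q ≤ 151` (the 10 primes of gap `≥ 4` in `[80, 157)`). [this cell, THETA-CERT-cc6 §F1 (kit j215104)] -/
def thetaTier1ChebRowsHead : List Row := [
    ⟨83, 89, 4, 34199923348, 9⟩, ⟨89, 97, 4, 40000000000, 9⟩, ⟨97, 101, 4, 19800673785, 9⟩, ⟨103, 107, 4, 18668924653, 9⟩,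
    ⟨109, 113, 4, 17659568876, 9⟩, ⟨113, 127, 4, 40000000000, 9⟩, ⟨127, 131, 4, 15195016003, 10⟩, ⟨131, 137, 4, 21943965287, 10⟩,
    ⟨139, 149, 4, 34041462679, 10⟩, ⟨151, 157, 4, 19093324581, 10⟩ ]

/-- Kernel verdict: every row passes the RS-free tier-1 check. [this cell, THETA-CERT-cc6 §D9] -/
theorem thetaTier1ChebRowsHead_check : checkAllCheb thetaTier1ChebRowsHead = true := by
  decide +kernel

/-- The REAL certificate inequalities of the head rows. [this cell, THETA-CERT-cc6 §D9] -/
theorem thetaTier1ChebRowsHead_realCert : ∀ r ∈ thetaTier1ChebRowsHead, r.RealCertCheb := checkAllCheb_sound thetaTier1ChebRowsHead_check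

/-- Row facts for `thetaTier1ChebRowsHead`: `m = 4`, `2 ≤ q`, and `q < q⁺` consecutive primes (trial division, kernel). [this cell] -/
theorem thetaTier1ChebRowsHead_facts : (thetaTier1ChebRowsHead.all fun r => (r.m == 4) && decide (2 ≤ r.q) && consecCheck r.q r.qn) = true := by
  decide +kernel

/-- The row facts, unpacked: `m = 4`, `2 ≤ q`, `ConsecutivePrimes q qn`. [this cell] -/
theorem thetaTier1ChebRowsHead_facts' : ∀ r ∈ thetaTier1ChebRowsHead, r.m = 4 ∧ 2 ≤ r.q ∧ Handoff.ConsecutivePrimes r.q r.qn := by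
  intro r hr
  have h := List.all_eq_true.1 thetaTier1ChebRowsHead_facts r hr
  simp only [Bool.and_eq_true, beq_iff_eq, decide_eq_true_eq] at h
  exact ⟨h.1.1, h.1.2, consecCheck_sound h.2⟩

end Summit.RiemannHypothesis.RiemannHypothesis.Theorems.ThetaTier1
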